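import Literature.Probability.Percolation.OpenPathAnnulusCrossing
import Literature.Probability.Percolation.LatticeWalksGM
import Literature.Probability.Percolation.CrossingChains
import Literature.Probability.Percolation.RSWProofs
import Literature.Probability.RandomPlanarGeometry.KlebanZagierCrossing
import Literature.Probability.RandomPlanarGeometry.KlebanZagierTheorem2
import Literature.Probability.RandomPlanarGeometry.CardyFunctionIncBeta
import Summits.CriticalPhenomena.CardyFormulaZ2.Theorems.CardyBoundaryCoulombGasStripClusterRatesRectBoxExists
import HarnessLib

/-!
# Stub `stub_z2QuadLowerBoundToBoxes` of line `birth` — crux `BoxFamilyToCardy` (stmt-CriticalPhenomena-14215)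

Registered stub 2b of the birth skeleton `Cruxes/BoxFamilyToCardy/Lines/birth.lean` (route
`CardyWickAnisotropy`, crux `BoxFamilyToCardy : AnisotropicBoxCardy → CardyFormulaZ2`), proved
verbatim, entirely on `ℤ²` at `p = 1/2`:

*if every origin-cornered left/right-marked rectangle `R = (0,w)×(0,h)` satisfies
`Π_h(w/h) − ε ≤ P_{1/2}[𝒞_{c/n}(R)]` for `n ≥ n₀(R, ε)` along some mesh scale `c = c(R, ε) > 0`
(`quadCrossingProb`, the Schramm–Smirnov crossing event of the quad by the open edges of
`(c/n)ℤ²`), then for all `p, q ≥ 1` the exact box-crossing probabilities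
`crossingProb half (p m) (q m − 1) = P_{1/2}(LR([0,pm]×[0,qm−1]))` converge to `Π_h(p/q)`*
(`Π_h = KlebanZagier.cardyPi`).

## Proof

* **Shadowing** (`quadCrossing_subset_lrCrossingAt`, `quadCrossingProb_le_crossingProb`). For `R`
  as above drawn against `δℤ²`, a continuum crossing (a path inside the closed box and inside
  `openEdgeUnion δ ω` from the left side to the right side) is a compact connected subset of the
  drawn open edges, so the first ends of the open edges it meets are chained by an open lattice path
  (`openConnIn_of_isPreconnected_subset_openEdgeUnion`; Schramm–Smirnov 2011, §1.3: "in the discrete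
  setting there is no difference between connected and path-connected crossings"). These ends have
  coordinates in `[-1, w/δ+1] × [-1, h/δ+1]`, the first has abscissa `≤ 1`, the last abscissa
  `≥ w/δ − 1`; clipping to the columns `[1, 1+M]` (`exists_openConnIn_clip`) gives an open
  left–right crossing of the translated box `(1,−1) + [0,M]×[0,N]` once `M + 2 ≤ w/δ` and
  `h/δ + 2 ≤ N`, whence `quadCrossingProb δ R ≤ crossingProb half M N` by translation invariance
  (`bondPercolation_real_lrCrossingAt`).
* **Lower bound** (`eventually_le_crossingProb_of_lt`, `eventually_cardyPi_sub_le_crossingProb`).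
  For `A > p/q` apply the hypothesis to the Bollobás–Riordan rectangle `brRect A 1 = (0,A)×(0,1)`
  (arcs `0`/`2` = left/right sides, `RectBoxExists.brRect_arc_zero/two`) at the matched mesh `c/n`,
  `n = ⌈c(pm+2)/A⌉`: then `pm + 2 ≤ A n/c` and, eventually in `m` (because `A > p/q`),
  `n/c + 2 ≤ qm − 1`, so `Π_h(A) − ε ≤ crossingProb half (pm) (qm−1)` eventually; let `A ↓ p/q`
  by continuity of `Π_h` on `(0,∞)` (`continuousAt_cardyPi`: `λ(i·)` is differentiable,
  `hasDerivAt_lamR`, with values in `(0,1)` where `F` is continuous, `continuousOn_cardyFunction_Ioo`).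
* **Upper bound.** Exact lattice duality
  `crossingProb half (pm) (qm−1) + crossingProb half (qm) (pm−1) = 1`
  (`crossingProb_add_crossingProb_symm_holds`, `symm_half`), the lower bound for the pair `(q, p)`,
  and `Π_h(q/p) = 1 − Π_h(p/q)` (`cardyPi_inv`, from `lamR_inv : λ(i/r) = 1 − λ(ir)` and
  `cardyFunction_one_sub_holds : F(1−η) = 1 − F(η)`).

No scaling covariance of `quadCrossingProb` is needed (the matched mesh `c/n` is compared with the
box directly). No new definitions.
References: O. Schramm, S. Smirnov, Ann. Probab. 39 (2011), §1.3 [SchrammSmirnov2011];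
G. Grimmett, *Percolation* (1999), §11.3 [GrimmettPercolation1999]; B. Bollobás, O. Riordan,
*Percolation* (2006), Ch. 3 Cor. 3(i) [BollobasRiordan2006]; P. Kleban, D. Zagier, J. Stat. Phys.
113 (2003), §§2–3 [KlebanZagier2003]; J. Cardy, J. Phys. A 25 (1992) L201 [Cardy1992].
-/

noncomputable section

open Filter Topology Set MeasureTheory Metric
open Literature.Probability.LatticeModels
open Literature.Probability.RandomPlanarGeometry
open Literature.Probability.Percolation
open Literature.Probability.RandomPlanarGeometry.KlebanZagier (cardyPi modularLambdaI lamR lamR_inv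
  lamR_mem_Ioo modularLambdaI_eq_lamR hasDerivAt_lamR)
open Summit.CriticalPhenomena.CardyFormulaZ2.Theorems.RectilinearCardy.Negative (brRect brRect_carrier)
open Summit.CriticalPhenomena.CardyFormulaZ2.Cruxes.StripClusterRates.TwoClusterRateIsStationaryGap
  (RectBoxExists.brRect_arc_zero RectBoxExists.brRect_arc_two)

namespace Summit.CriticalPhenomena.CardyFormulaZ2.Cruxes.BoxFamilyToCardy.Birth

/-- The closed box: `closure ((0,w)×(0,h)) = [0,w]×[0,h]` for `w, h > 0`. [folklore] -/
theorem closure_openBox {w h : ℝ} (hw : 0 < w) (hh : 0 < h) :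
    closure (Ioo (0:ℝ) w ×ℂ Ioo (0:ℝ) h) = Icc (0:ℝ) w ×ℂ Icc (0:ℝ) h := by
  rw [Complex.closure_reProdIm, closure_Ioo hw.ne, closure_Ioo hh.ne]

/-- The first end of a lattice edge drawn (at mesh `δ > 0`) through a point `z` is coordinatewise
within `δ` of `z`. [folklore] -/
theorem abs_coord_sub_le_of_mem_segment {δ : ℝ} (hδ : 0 < δ) {x y : Site 2}
    (hxy : (zdGraph 2).Adj x y) {z : ℂ} (hz : z ∈ segment ℝ (meshPoint δ x) (meshPoint δ y)) :
    |δ * (x 0 : ℝ) - z.re| ≤ δ ∧ |δ * (x 1 : ℝ) - z.im| ≤ δ := by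
  have hd := dist_meshPoint_le_of_mem_segment hδ hxy hz
  rw [dist_eq_norm] at hd
  have h1 := Complex.abs_re_le_norm (meshPoint δ x - z)
  have h2 := Complex.abs_im_le_norm (meshPoint δ x - z)
  rw [Complex.sub_re, meshPoint_re] at h1
  rw [Complex.sub_im, meshPoint_im] at h2
  exact ⟨h1.trans hd, h2.trans hd⟩

/-- Points of the translated left side `u + ({0} × [0,n])` of the lattice box, in coordinates.
[folklore] -/
theorem mem_image_leftSide_iff {u z : Site 2} {M n : ℕ} :
    z ∈ (· + u) '' (leftSide M n : Set (Site 2)) ↔ z 0 = u 0 ∧ u 1 ≤ z 1 ∧ z 1 ≤ u 1 + n := by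
  constructor
  · rintro ⟨b, hb, rfl⟩
    have hb' := Finset.mem_filter.1 (Finset.mem_coe.1 hb)
    have hb'' := mem_rectangle_iff.1 hb'.1
    simp only [Pi.add_apply]
    omega
  · intro h
    refine ⟨z - u, Finset.mem_coe.2 (Finset.mem_filter.2 ⟨mem_rectangle_iff.2 ?_, ?_⟩),
      sub_add_cancel z u⟩
    · simp only [Pi.sub_apply]; omega
    · simp only [Pi.sub_apply]; omega

/-- Points of the translated right side `u + ({M} × [0,n])` of the lattice box, in coordinates.
[folklore] -/
theorem mem_image_rightSide_iff {u z : Site 2} {M n : ℕ} :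
    z ∈ (· + u) '' (rightSide M n : Set (Site 2)) ↔ z 0 = u 0 + M ∧ u 1 ≤ z 1 ∧ z 1 ≤ u 1 + n := by
  constructor
  · rintro ⟨b, hb, rfl⟩
    have hb' := Finset.mem_filter.1 (Finset.mem_coe.1 hb)
    have hb'' := mem_rectangle_iff.1 hb'.1
    simp only [Pi.add_apply]
    omega
  · intro h
    refine ⟨z - u, Finset.mem_coe.2 (Finset.mem_filter.2 ⟨mem_rectangle_iff.2 ?_, ?_⟩),
      sub_add_cancel z u⟩
    · simp only [Pi.sub_apply]; omega
    · simp only [Pi.sub_apply]; omega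

/-- **Shadowing (event form).** For a conformal rectangle `R` with carrier `(0,w)×(0,h)`, arc `0`
the left side and arc `2` the right side, mesh `δ > 0`, and naturals `M`, `N` with `M + 2 ≤ w/δ`,
`h/δ + 2 ≤ N`: on a lattice configuration, a Schramm–Smirnov crossing `ω ∈ quadCrossing R δ` yields
an open left–right crossing of the translated lattice box `(1,-1) + [0,M]×[0,N]` (chain the ends of
the open edges drawn through the continuum crossing, `openConnIn_of_isPreconnected_subset_openEdgeUnion`,
then clip to the columns `[1, 1+M]`, `exists_openConnIn_clip`).
[cite: SchrammSmirnov2011, §1.3 ("no difference between connected and path-connected crossings")] -/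
theorem quadCrossing_subset_lrCrossingAt {R : ConformalRectangle} {w h δ : ℝ} (hw : 0 < w)
    (hh : 0 < h) (hδ : 0 < δ) (hcar : R.carrier = Ioo (0:ℝ) w ×ℂ Ioo (0:ℝ) h)
    (h0 : R.arc 0 = {z : ℂ | z.re = 0 ∧ z.im ∈ Icc (0:ℝ) h})
    (h2 : R.arc 2 = {z : ℂ | z.re = w ∧ z.im ∈ Icc (0:ℝ) h}) {M N : ℕ}
    (hM : (M : ℝ) + 2 ≤ w / δ) (hN : h / δ + 2 ≤ N) {ω : BondConfig (Site 2)}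
    (hω : ω ⊆ (zdGraph 2).edgeSet) (hq : ω ∈ quadCrossing R δ) :
    ω ∈ lrCrossingAt ![(1:ℤ), -1] M N := by
  obtain ⟨a, ha, b, hb, hJ⟩ := hq
  -- the continuum crossing as a compact connected subset of the drawn open edges
  set γ := hJ.somePath with hγ
  have hγmem : ∀ t, γ t ∈ closure R.carrier ∩ openEdgeUnion δ ω := hJ.somePath_mem
  set K : Set ℂ := range γ with hK
  have hKc : IsCompact K := isCompact_range γ.continuous
  have hKconn : IsPreconnected K := isPreconnected_range γ.continuous
  have hKO : K ⊆ openEdgeUnion δ ω := by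
    rintro _ ⟨t, rfl⟩
    exact (hγmem t).2
  have hKcl : K ⊆ Icc (0:ℝ) w ×ℂ Icc (0:ℝ) h := by
    rintro _ ⟨t, rfl⟩
    rw [← closure_openBox hw hh, ← hcar]
    exact (hγmem t).1
  have haK : a ∈ K := ⟨0, γ.source⟩
  have hbK : b ∈ K := ⟨1, γ.target⟩
  -- the ends of the open edges drawn through `K`
  set S : Set (Site 2) := {v | -1 ≤ v 0 ∧ ((v 0 : ℤ) : ℝ) ≤ w / δ + 1 ∧ -1 ≤ v 1 ∧
    ((v 1 : ℤ) : ℝ) ≤ h / δ + 1} with hSdef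
  have lower : ∀ {k : ℤ} {r : ℝ}, 0 ≤ r → |δ * (k : ℝ) - r| ≤ δ → -1 ≤ k := by
    intro k r hr habs
    have h1 := (abs_le.1 habs).1
    have h2 : δ * (-1) ≤ δ * (k : ℝ) := by linarith
    have h3 := le_of_mul_le_mul_left h2 hδ
    exact_mod_cast h3
  have upper : ∀ {k : ℤ} {r c : ℝ}, r ≤ c → |δ * (k : ℝ) - r| ≤ δ → (k : ℝ) ≤ c / δ + 1 := by
    intro k r c hr habs
    have h1 := (abs_le.1 habs).2
    rw [div_add_one hδ.ne', le_div_iff₀ hδ]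
    linarith
  have hS : ∀ p ∈ edgePairs δ ω K, p.1 ∈ S := by
    rintro ⟨x, y⟩ ⟨hadj, -, z, hzs, hzK⟩
    obtain ⟨⟨hz0, hzw⟩, ⟨hz0', hzh⟩⟩ := Complex.mem_reProdIm.1 (hKcl hzK)
    obtain ⟨hre, him⟩ := abs_coord_sub_le_of_mem_segment hδ hadj hzs
    exact ⟨lower hz0 hre, upper hzw hre, lower hz0' him, upper hzh him⟩
  obtain ⟨p₀, hp₀, h0s⟩ := exists_mem_edgePairs_of_mem hKO haK
  obtain ⟨p₁, hp₁, h1s⟩ := exists_mem_edgePairs_of_mem hKO hbK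
  have hconn := openConnIn_of_isPreconnected_subset_openEdgeUnion hδ hKc hKconn hKO hS hp₀ hp₁
  -- abscissae of the first and last ends
  have hx : p₀.1 0 ≤ 1 := by
    rw [h0] at ha
    obtain ⟨hre, -⟩ := abs_coord_sub_le_of_mem_segment hδ hp₀.1 h0s
    rw [ha.1, sub_zero, abs_le] at hre
    have h2 : δ * ((p₀.1 0 : ℤ) : ℝ) ≤ δ * 1 := by linarith
    have h3 := le_of_mul_le_mul_left h2 hδ
    exact_mod_cast h3
  have hy : 1 + (M : ℤ) ≤ p₁.1 0 := by
    rw [h2] at hb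
    obtain ⟨hre, -⟩ := abs_coord_sub_le_of_mem_segment hδ hp₁.1 h1s
    rw [hb.1, abs_le] at hre
    have h3 : ((M : ℝ) + 2) * δ ≤ w := by rwa [← le_div_iff₀ hδ]
    have h4 : δ * (1 + (M : ℝ)) ≤ δ * ((p₁.1 0 : ℤ) : ℝ) := by nlinarith
    have h5 := le_of_mul_le_mul_left h4 hδ
    exact_mod_cast h5
  -- clip to the columns `[1, 1 + M]`
  obtain ⟨x', y', hx', hy', hconn'⟩ := exists_openConnIn_clip hω (fun v : Site 2 => v 0)
    (fun u v huv => (zdGraph_adj_apply_le huv 0).1) (a := 1) (b := 1 + (M : ℤ)) (by omega) hx hy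
    hconn
  obtain ⟨hx'S, hy'S, hr⟩ := hconn'
  have hx'S' := hx'S
  have hy'S' := hy'S
  simp only [mem_inter_iff, hSdef, mem_setOf_eq] at hx'S' hy'S'
  have hNr : ∀ {k : ℤ}, (k : ℝ) ≤ h / δ + 1 → k ≤ -1 + (N : ℤ) := by
    intro k hk
    have : (k : ℝ) ≤ (N : ℝ) - 1 := by linarith
    have : ((k : ℤ) : ℝ) ≤ (((N : ℤ) - 1 : ℤ) : ℝ) := by push_cast; linarith
    have := Int.cast_le.1 this
    omega
  refine ⟨x', ?_, y', ?_, openConnIn_mono ?_ _ _ ⟨hx'S, hy'S, hr⟩⟩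
  · rw [mem_image_leftSide_iff]
    simp only [Matrix.cons_val_zero, Matrix.cons_val_one]
    exact ⟨hx', hx'S'.1.2.2.1, hNr hx'S'.1.2.2.2⟩
  · rw [mem_image_rightSide_iff]
    simp only [Matrix.cons_val_zero, Matrix.cons_val_one]
    exact ⟨hy', hy'S'.1.2.2.1, hNr hy'S'.1.2.2.2⟩
  · rintro v ⟨hvS, hv1, hv2⟩
    rw [mem_image_rectangle_iff]
    simp only [Matrix.cons_val_zero, Matrix.cons_val_one]
    exact ⟨hv1, hv2, hvS.2.2.1, hNr hvS.2.2.2⟩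

/-- **Shadowing (probability form): `P[𝒞_δ(R)] ≤ P(LR([0,M]×[0,N]))`** for a conformal rectangle
`R` with carrier `(0,w)×(0,h)`, arc `0` / arc `2` its left / right side, mesh `δ > 0`, and
`M + 2 ≤ w/δ`, `h/δ + 2 ≤ N` (event form `quadCrossing_subset_lrCrossingAt` on the almost sure set
of lattice configurations, and translation invariance `bondPercolation_real_lrCrossingAt`).
[cite: SchrammSmirnov2011, §1.3] -/
theorem quadCrossingProb_le_crossingProb {R : ConformalRectangle} {w h δ : ℝ} (hw : 0 < w)
    (hh : 0 < h) (hδ : 0 < δ) (hcar : R.carrier = Ioo (0:ℝ) w ×ℂ Ioo (0:ℝ) h)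
    (h0 : R.arc 0 = {z : ℂ | z.re = 0 ∧ z.im ∈ Icc (0:ℝ) h})
    (h2 : R.arc 2 = {z : ℂ | z.re = w ∧ z.im ∈ Icc (0:ℝ) h}) {M N : ℕ}
    (hM : (M : ℝ) + 2 ≤ w / δ) (hN : h / δ + 2 ≤ N) :
    quadCrossingProb δ R ≤ crossingProb half M N := by
  rw [← bondPercolation_real_lrCrossingAt half ![(1:ℤ), -1] M N, quadCrossingProb]
  refine ENNReal.toReal_mono (measure_ne_top _ _) (measure_mono_ae ?_)
  filter_upwards [ae_subset_edgeSet (zdGraph 2) half] with ω hω hq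
  exact quadCrossing_subset_lrCrossingAt hw hh hδ hcar h0 h2 hM hN hω hq


/-! ### Cardy's function of the aspect ratio: continuity on `(0,∞)` and the duality `Π_h(1/r) = 1 - Π_h(r)` -/

/-- `Π_h(r) = F(λ(ir))` with the tree's real `λ`-function `lamR` on the positive axis
(`modularLambdaI_eq_lamR`). [cite: KlebanZagier2003, §2–3] -/
theorem cardyPi_eq_cardyFunction_lamR {r : ℝ} (hr : 0 < r) :
    cardyPi r = Literature.Probability.RandomPlanarGeometry.cardyFunction (lamR r) := by
  rw [cardyPi, modularLambdaI_eq_lamR hr]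

/-- **Duality of Cardy's function of the aspect ratio: `Π_h(1/r) = 1 - Π_h(r)`** (`r > 0`):
`λ(i/r) = 1 - λ(ir)` (`lamR_inv`) and `F(1-η) = 1 - F(η)` (`cardyFunction_one_sub_holds`).
[cite: KlebanZagier2003, §5 (ii)] -/
theorem cardyPi_inv {r : ℝ} (hr : 0 < r) : cardyPi r⁻¹ = 1 - cardyPi r := by
  rw [cardyPi_eq_cardyFunction_lamR (inv_pos.2 hr), cardyPi_eq_cardyFunction_lamR hr, lamR_inv hr,
    cardyFunction_one_sub_holds (Ioo_subset_Icc_self (lamR_mem_Ioo hr))]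

/-- **Continuity of `Π_h` on `(0,∞)`**: `λ(i·)` is differentiable on the positive axis
(`hasDerivAt_lamR`) with values in `(0,1)` (`lamR_mem_Ioo`), where `F` is continuous
(`continuousOn_cardyFunction_Ioo`). [folklore] -/
theorem continuousAt_cardyPi {r : ℝ} (hr : 0 < r) : ContinuousAt cardyPi r := by
  have h1 : (fun t => Literature.Probability.RandomPlanarGeometry.cardyFunction (lamR t)) =ᶠ[𝓝 r]
      cardyPi := by
    filter_upwards [Ioi_mem_nhds hr] with t ht
    exact (cardyPi_eq_cardyFunction_lamR ht).symm
  have h2 : ContinuousAt lamR r := (hasDerivAt_lamR hr).continuousAt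
  have h3 : ContinuousAt Literature.Probability.RandomPlanarGeometry.cardyFunction (lamR r) :=
    continuousOn_cardyFunction_Ioo.continuousAt (Ioo_mem_nhds (lamR_mem_Ioo hr).1 (lamR_mem_Ioo hr).2)
  exact (h3.comp h2).congr h1

/-! ### The lower bound along the box family -/

/-- **Lower bound at a wider aspect ratio.** Under the hypothesis of the stub, for `p/q < A` and
`ε > 0`, EVENTUALLY in `m`: `Π_h(A) - ε ≤ P_{1/2}(LR([0,pm]×[0,qm-1]))`. Apply the hypothesis to
the Bollobás–Riordan rectangle `brRect A 1 = (0,A)×(0,1)` (arcs `0`/`2` = left/right sides), at the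
mesh `c/n`, `n = ⌈c(pm+2)/A⌉`, for which `pm + 2 ≤ A n/c` and (eventually, as `A > p/q`)
`n/c + 2 ≤ qm - 1`, and shadow the continuum crossing by a lattice crossing of the box
(`quadCrossingProb_le_crossingProb`). [folklore] -/
theorem eventually_le_crossingProb_of_lt
    (H : ∀ (R : ConformalRectangle) (w h : ℝ), 0 < w → 0 < h →
        R.carrier = Set.Ioo (0:ℝ) w ×ℂ Set.Ioo (0:ℝ) h →
        R.arc 0 = {z : ℂ | z.re = 0 ∧ z.im ∈ Set.Icc (0:ℝ) h} →
        R.arc 2 = {z : ℂ | z.re = w ∧ z.im ∈ Set.Icc (0:ℝ) h} →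
        ∀ ε : ℝ, 0 < ε → ∃ c : ℝ, 0 < c ∧ ∃ n₀ : ℕ, ∀ n : ℕ, n₀ ≤ n →
          cardyPi (w / h) - ε ≤ quadCrossingProb (c / n) R)
    {p q : ℕ} (hp : 1 ≤ p) (hq : 1 ≤ q) {A : ℝ} (hA : (p : ℝ) / q < A) {ε : ℝ} (hε : 0 < ε) :
    ∀ᶠ m : ℕ in atTop, cardyPi A - ε ≤ crossingProb half (p * m) (q * m - 1) := by
  have hp0 : (0 : ℝ) < p := Nat.cast_pos.2 hp
  have hq0 : (0 : ℝ) < q := Nat.cast_pos.2 hq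
  have hA0 : 0 < A := lt_trans (div_pos hp0 hq0) hA
  obtain ⟨c, hc, n₀, hn₀⟩ := H (brRect A 1 hA0 one_pos) A 1 hA0 one_pos (brRect_carrier A 1 hA0 one_pos)
    (RectBoxExists.brRect_arc_zero A 1 hA0 one_pos) (RectBoxExists.brRect_arc_two A 1 hA0 one_pos) ε hε
  simp only [div_one] at hn₀
  have hgap : 0 < (q : ℝ) - p / A := by
    rw [sub_pos, div_lt_iff₀ hA0]
    rw [div_lt_iff₀ hq0] at hA
    linarith
  have h1 : Tendsto (fun m : ℕ => (m : ℝ) * ((q : ℝ) - p / A)) atTop atTop :=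
    tendsto_natCast_atTop_atTop.atTop_mul_const hgap
  have h2 : Tendsto (fun m : ℕ => c * ((p : ℝ) * m + 2) / A) atTop atTop := by
    have h : Tendsto (fun m : ℕ => (p : ℝ) * m + 2) atTop atTop :=
      (tendsto_natCast_atTop_atTop.const_mul_atTop hp0).atTop_add tendsto_const_nhds
    exact (h.const_mul_atTop hc).atTop_div_const hA0
  filter_upwards [h1.eventually_ge_atTop (3 + 2 / A + 1 / c), h2.eventually_ge_atTop (n₀ : ℝ),
    eventually_ge_atTop 1] with m hm1 hm2 hm3
  -- the matched mesh `c / n`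
  set n : ℕ := ⌈c * ((p : ℝ) * m + 2) / A⌉₊ with hn
  have hn_ge : c * ((p : ℝ) * m + 2) / A ≤ n := Nat.le_ceil _
  have hpos : 0 < c * ((p : ℝ) * m + 2) / A := by positivity
  have hn_lt : (n : ℝ) < c * ((p : ℝ) * m + 2) / A + 1 := Nat.ceil_lt_add_one hpos.le
  have hn₀n : n₀ ≤ n := by
    have : (n₀ : ℝ) ≤ n := hm2.trans hn_ge
    exact_mod_cast this
  have hnpos : (0 : ℝ) < n := hpos.trans_le hn_ge
  have hδ : 0 < c / n := div_pos hc hnpos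
  -- the box `[0, pm] × [0, qm-1]` fits: `pm + 2 ≤ A/(c/n)` and `1/(c/n) + 2 ≤ qm - 1`
  have hM : ((p * m : ℕ) : ℝ) + 2 ≤ A / (c / n) := by
    have h' := (div_le_iff₀ hA0).1 hn_ge
    rw [le_div_iff₀ hδ, ← mul_div_assoc, div_le_iff₀ hnpos]
    push_cast
    linarith
  have hqm : 1 ≤ q * m := Nat.mul_pos hq hm3
  have hN : 1 / (c / n) + 2 ≤ ((q * m - 1 : ℕ) : ℝ) := by
    rw [Nat.cast_sub hqm, one_div_div]
    push_cast
    have f1 : (n : ℝ) / c < (p : ℝ) * m / A + 2 / A + 1 / c := by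
      rw [div_lt_iff₀ hc]
      have e : ((p : ℝ) * m / A + 2 / A + 1 / c) * c = c * ((p : ℝ) * m + 2) / A + 1 := by
        field_simp
      rw [e]
      exact hn_lt
    have e2 : (m : ℝ) * ((q : ℝ) - p / A) = (q : ℝ) * m - (p : ℝ) * m / A := by ring
    rw [e2] at hm1
    linarith
  have key := quadCrossingProb_le_crossingProb hA0 one_pos hδ (brRect_carrier A 1 hA0 one_pos)
    (RectBoxExists.brRect_arc_zero A 1 hA0 one_pos) (RectBoxExists.brRect_arc_two A 1 hA0 one_pos)
    hM hN
  exact (hn₀ n hn₀n).trans key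

/-- **Lower bound along the box family: `liminf_m P_{1/2}(LR([0,pm]×[0,qm-1])) ≥ Π_h(p/q)`**, in
the form: for every `ε > 0`, EVENTUALLY `Π_h(p/q) - ε ≤ crossingProb half (pm) (qm-1)`
(`eventually_le_crossingProb_of_lt` at aspect ratios `A ↓ p/q`, continuity of `Π_h`). [folklore] -/
theorem eventually_cardyPi_sub_le_crossingProb
    (H : ∀ (R : ConformalRectangle) (w h : ℝ), 0 < w → 0 < h →
        R.carrier = Set.Ioo (0:ℝ) w ×ℂ Set.Ioo (0:ℝ) h →
        R.arc 0 = {z : ℂ | z.re = 0 ∧ z.im ∈ Set.Icc (0:ℝ) h} →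
        R.arc 2 = {z : ℂ | z.re = w ∧ z.im ∈ Set.Icc (0:ℝ) h} →
        ∀ ε : ℝ, 0 < ε → ∃ c : ℝ, 0 < c ∧ ∃ n₀ : ℕ, ∀ n : ℕ, n₀ ≤ n →
          cardyPi (w / h) - ε ≤ quadCrossingProb (c / n) R)
    {p q : ℕ} (hp : 1 ≤ p) (hq : 1 ≤ q) {ε : ℝ} (hε : 0 < ε) :
    ∀ᶠ m : ℕ in atTop, cardyPi ((p : ℝ) / q) - ε ≤ crossingProb half (p * m) (q * m - 1) := by
  have hp0 : (0 : ℝ) < p := Nat.cast_pos.2 hp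
  have hq0 : (0 : ℝ) < q := Nat.cast_pos.2 hq
  have ha : 0 < (p : ℝ) / q := div_pos hp0 hq0
  have hcont := continuousAt_cardyPi ha
  rw [Metric.continuousAt_iff] at hcont
  obtain ⟨η, hη, hη'⟩ := hcont (ε / 2) (half_pos hε)
  have hA : (p : ℝ) / q < (p : ℝ) / q + η / 2 := by linarith
  have hdist : dist ((p : ℝ) / q + η / 2) ((p : ℝ) / q) < η := by
    rw [Real.dist_eq, add_sub_cancel_left, abs_of_pos (half_pos hη)]
    linarith
  have hclose := hη' hdist
  rw [Real.dist_eq, abs_lt] at hclose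
  filter_upwards [eventually_le_crossingProb_of_lt H hp hq hA (half_pos hε)] with m hm
  linarith [hclose.1]

/-! ### The stub -/

/-- **Stub 2b of line `birth` (crux `BoxFamilyToCardy`): from Schramm–Smirnov lower bounds to Cardy
for the lattice boxes of `ℤ²` (rational aspect ratios).** If every origin-cornered left/right-marked
rectangle `(0,w)×(0,h)` has `liminf_n P_{1/2}[𝒞_{c/n}(R)] ≥ Π_h(w/h) − ε` along some mesh scale
`c = c(R, ε) > 0`, then for all `p, q ≥ 1`, `crossingProb half (p m) (q m − 1) → Π_h(p/q)`.
LOWER bound: `eventually_cardyPi_sub_le_crossingProb` (shadowing, Part 1). UPPER bound: exact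
lattice duality `crossingProb half (p m) (q m − 1) + crossingProb half (q m) (p m − 1) = 1`
(`crossingProb_add_crossingProb_symm_holds`, `symm_half`), the lower bound for the pair `(q, p)`,
and `Π_h(q/p) = 1 − Π_h(p/q)` (`cardyPi_inv`). [folklore] -/
theorem stub_z2QuadLowerBoundToBoxes :
    (∀ (R : ConformalRectangle) (w h : ℝ), 0 < w → 0 < h →
        R.carrier = Set.Ioo (0:ℝ) w ×ℂ Set.Ioo (0:ℝ) h →
        R.arc 0 = {z : ℂ | z.re = 0 ∧ z.im ∈ Set.Icc (0:ℝ) h} →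
        R.arc 2 = {z : ℂ | z.re = w ∧ z.im ∈ Set.Icc (0:ℝ) h} →
        ∀ ε : ℝ, 0 < ε → ∃ c : ℝ, 0 < c ∧ ∃ n₀ : ℕ, ∀ n : ℕ, n₀ ≤ n →
          cardyPi (w / h) - ε ≤ quadCrossingProb (c / n) R) →
      ∀ p q : ℕ, 1 ≤ p → 1 ≤ q →
        Tendsto (fun m : ℕ ↦ crossingProb half (p * m) (q * m - 1)) atTop
          (𝓝 (cardyPi ((p : ℝ) / (q : ℝ)))) := by
  intro H p q hp hq
  have hp0 : (0 : ℝ) < p := Nat.cast_pos.2 hp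
  have hq0 : (0 : ℝ) < q := Nat.cast_pos.2 hq
  refine tendsto_order.2 ⟨fun a ha => ?_, fun b hb => ?_⟩
  · have hε : 0 < (cardyPi ((p : ℝ) / q) - a) / 2 := by linarith
    filter_upwards [eventually_cardyPi_sub_le_crossingProb H hp hq hε] with m hm
    linarith
  · have hε : 0 < (b - cardyPi ((p : ℝ) / q)) / 2 := by linarith
    have hdual : cardyPi ((q : ℝ) / p) = 1 - cardyPi ((p : ℝ) / q) := by
      rw [← inv_div, cardyPi_inv (div_pos hp0 hq0)]
    filter_upwards [eventually_cardyPi_sub_le_crossingProb H hq hp hε, eventually_ge_atTop 1]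
      with m hm hm1
    have hsum := crossingProb_add_crossingProb_symm_holds half (p * m - 1) (q * m - 1)
    rw [symm_half, Nat.sub_add_cancel (Nat.mul_pos hp hm1), Nat.sub_add_cancel (Nat.mul_pos hq hm1)]
      at hsum
    linarith

end Summit.CriticalPhenomena.CardyFormulaZ2.Cruxes.BoxFamilyToCardy.Birth

end
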